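import Summits.HubbardSuperconductivity.HubbardSuperconductivity.Theorems.AnisotropyChordTransferFibre3FinXDCheck

/-!
# Route `AnisotropyChord` / H0 rotor rung: FIN per-`L` row-D (KT-2a″) cell facts, `L = 10`, cells 90–94

Kernel facts `xdCellAny0 10 (49/50) la lb aD = true` (in-kernel point tables, zero data; `decide +kernel`) for the combined-cell
grid of `L = 10` (g5 design, 1–2.5 % cells); assembled in `…FinXDTen`.  Prover seat `hubbard-h0-rotor-p3` g7; helper for piece A =
stmt-HubbardSuperconductivity-23918 of rung 19089 (`--supports`, helper class).  WHAT THIS IS NOT: nothing here proves superconductivity in the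
Hubbard model (rotor TARGET as worded stays FALSE, g15 verdict); kernel facts for ONE hypothesis of ONE conditional reduction.  No sorry.
-/

set_option linter.dupNamespace false
set_option autoImplicit false

namespace Summit.HubbardSuperconductivity.HubbardSuperconductivity.Theorems.AnisotropyChord.Transfer.Fibre3

namespace FinXD

/-- cell 90 of `L = 10` (`cert`). [folklore] -/
theorem xd10_90 : xdCellAny0 10 (49/50 : ℚ) 5296586182623311 5429000837188894 (3/50 : ℚ) = true := by decide +kernel

/-- cell 91 of `L = 10` (`cert`). [folklore] -/
theorem xd10_91 : xdCellAny0 10 (49/50 : ℚ) 5429000837188894 5564725858118617 (3/50 : ℚ) = true := by decide +kernel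

/-- cell 92 of `L = 10` (`cert`). [folklore] -/
theorem xd10_92 : xdCellAny0 10 (49/50 : ℚ) 5564725858118617 5703844004571583 (3/50 : ℚ) = true := by decide +kernel

/-- cell 93 of `L = 10` (`cert`). [folklore] -/
theorem xd10_93 : xdCellAny0 10 (49/50 : ℚ) 5703844004571583 5846440104685873 (3/50 : ℚ) = true := by decide +kernel

/-- cell 94 of `L = 10` (`cert`). [folklore] -/
theorem xd10_94 : xdCellAny0 10 (49/50 : ℚ) 5846440104685873 5992601107303020 (3/50 : ℚ) = true := by decide +kernel

end FinXD

end Summit.HubbardSuperconductivity.HubbardSuperconductivity.Theorems.AnisotropyChord.Transfer.Fibre3
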